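import Mathlib
import Literature.AlgebraicGeometry.Resolution.LocalBlowup
import Literature.AlgebraicGeometry.Resolution.TranscendenceDefect
import Literature.RingTheory.KrullDimension.AffineDimension
import Literature.RingTheory.KrullDimension.LocalizationDimension
import Summits.ResolutionOfSingularities.ResolutionOfSingularities.Theorems.RadicialJungCleanModelsLens5UnimodularRefinement
import Summits.ResolutionOfSingularities.ResolutionOfSingularities.Theorems.RadicialJungCleanModelsLens5UnimodularRefinement2
import Summits.ResolutionOfSingularities.ResolutionOfSingularities.Theorems.RadicialJungCleanModelsLens5UnimodularRefinement3
import Summits.ResolutionOfSingularities.ResolutionOfSingularities.Theorems.RadicialJungCleanModelsLens5UnimodularRefinement4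
import Summits.ResolutionOfSingularities.ResolutionOfSingularities.Theorems.RadicialJungCleanModelsLens5RankOneArchimedean
import Summits.ResolutionOfSingularities.ResolutionOfSingularities.Theorems.RadicialJungCleanModelsLens5PRankTwoPort1
import Summits.ResolutionOfSingularities.ResolutionOfSingularities.Theorems.RadicialJungCleanModelsLens5PRankTwoLattice
import HarnessLib

/-!
# PORT (T-slice module map §16 (v), part 2) of res-B-lens-5's companion `Lens5_PRankTwoLattice.lean` rev 1: (3-L-c) the lattice charts
# (`latticeChart_of_archimedean`, `latticeChart_of_twoLevel`), (3-L-d) `valueGroup_twoLevel_data`, and PORT 3-L `port_toricChart_lattice`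

Author res-B-lens-5 (g10); ported verbatim by res-B-lead-1.  OURS; nothing here proves resolution in characteristic `p`.
-/

noncomputable section

set_option linter.dupNamespace false -- mandated namespace of this single-conjunct summit

open IsLocalRing
open Literature.AlgebraicGeometry.Resolution
open Summit.ResolutionOfSingularities.ResolutionOfSingularities.Theorems.RadicialJung.CleanModels
open Summit.ResolutionOfSingularities.ResolutionOfSingularities.Theorems.RadicialJung.CleanModels.Lens5

namespace Summit.ResolutionOfSingularities.ResolutionOfSingularities.Theorems.RadicialJung.CleanModels.Lens5.PRankTwoAssembly

set_option linter.unusedVariables false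

/-- **(3-L-c1) ABSTRACT LATTICE CHART, archimedean weights** — the ✓ `toric_lemma_classB` (`Lens5_UnimodularRefinement.lean` rev 9
e40b13a8bffb :881, kernel clause included) read out as a chart `M : Fin 3 → L` with `ρ ∈ {1,2}` positive vectors: weights `> 0` on
`M j, j < ρ`, `= 0` on `M j, ρ ≤ j`; every `f ∈ F` has integer coordinates on `M` that are `≥ 0` on the positive block and `> 0`
somewhere there; every weight-zero `f` has coordinates vanishing on the positive block.  (Read-out: branch 1 ↦ `ρ = 2`, `M = (m₁, m₂,
e 2)`, `d = ((r₀a + r₁c), (r₀b' + r₁d), r₂)`; branch 2 ↦ `ρ = 1`, `M = (e i₀, e i₁, e i₂)`, `d = e.repr` permuted.)  PROVED (rev 7). [folklore] -/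
theorem latticeChart_of_archimedean {L : Type} [AddCommGroup L] (b : Module.Basis (Fin 3) ℤ L)
    {W : Type} [AddCommGroup W] [LinearOrder W] [IsOrderedAddMonoid W] [Archimedean W] (φ : L →+ W)
    (hrel : ∃ x : L, x ≠ 0 ∧ φ x = 0) (hne : ∃ x : L, φ x ≠ 0) (F : Finset L) (hF : ∀ f ∈ F, 0 < φ f) :
    ∃ (ρ : ℕ), (ρ = 1 ∨ ρ = 2) ∧ ∃ M : Fin 3 → L,
      (∀ j : Fin 3, (j : ℕ) < ρ → 0 < φ (M j)) ∧ (∀ j : Fin 3, ρ ≤ (j : ℕ) → φ (M j) = 0) ∧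
      (∀ f ∈ F, ∃ d : Fin 3 → ℤ, f = ∑ j, d j • M j ∧ (∀ j : Fin 3, (j : ℕ) < ρ → 0 ≤ d j) ∧
        ∃ j : Fin 3, (j : ℕ) < ρ ∧ 0 < d j) ∧
      (∀ f : L, φ f = 0 → ∃ d : Fin 3 → ℤ, f = ∑ j, d j • M j ∧ ∀ j : Fin 3, (j : ℕ) < ρ → d j = 0) := by
  classical
  rcases UnimodularRefinement.toric_lemma_classB b φ hrel hne F hF with
    ⟨e, m₁, m₂, a, b', c, d, he2, hdet, he0, he1, hm₁, hm₂, hkc, hFc⟩ | ⟨e, i₀, hpos, hker, hrepr, hposc⟩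
  · exact readout_rank_two φ F e m₁ m₂ a b' c d he2 hm₁ hm₂ hkc fun f hf =>
      let h := hFc f hf
      ⟨h.1, h.2.1.le, h.2.2.le, Or.inl h.2.1⟩
  · refine readout_rank_one φ F e i₀ hpos hker (fun f hf => hposc f (hF f hf)) fun f hf => ?_
    have h := hrepr f
    rw [hf] at h
    rcases lt_trichotomy (e.repr f i₀) 0 with hlt | heq | hgt
    · refine absurd h.symm (ne_of_lt ?_)
      have h' := zsmul_pos hpos (neg_pos.mpr hlt)
      rw [neg_zsmul] at h'
      exact neg_pos.mp h'
    · exact heq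
    · exact absurd h.symm (ne_of_gt (zsmul_pos hpos hgt))

/-- **(3-L-c2) ABSTRACT LATTICE CHART, two-level weights** — the same chart when the weight group `W` carries a monotone `ψ : W → W₁`
with `W₁` and `ker ψ` both of "rank ≤ 1" (any two elements `ℤ`-dependent): CASE 1 (two independent kernel vectors of `φ`) by the ✓
`exists_kernel_adapted_basis_of_rank_two_ker_pos` (`ρ = 1`); CASE 2: then `ψ ∘ φ ≠ 0` AUTOMATICALLY (else `φ(bᵢ) ∈ ker ψ` are pairwise
dependent, giving CASE 1), so the ✓ `exists_two_level_reading` (:1121) yields `φ₁, φ₂ : L →+ ℤ` with `0 < φ ⟺` lex-positive and `φ = 0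
⟺ φ₁ = φ₂ = 0`, and the ✓ `toric_lemma_classC` (:930) is read out as in (3-L-c1).  No counting argument / (P2) is needed for `hne`.
PROVED (rev 7). [folklore] -/
theorem latticeChart_of_twoLevel {L : Type} [AddCommGroup L] (b : Module.Basis (Fin 3) ℤ L)
    {W W₁ : Type} [AddCommGroup W] [LinearOrder W] [IsOrderedAddMonoid W]
    [AddCommGroup W₁] [LinearOrder W₁] [IsOrderedAddMonoid W₁] (φ : L →+ W) (ψ : W →+ W₁) (hψ : Monotone ψ)
    (hW₁ : ∀ w w' : W₁, ∃ s t : ℤ, (s ≠ 0 ∨ t ≠ 0) ∧ s • w + t • w' = 0)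
    (hΔ : ∀ w w' : W, ψ w = 0 → ψ w' = 0 → ∃ s t : ℤ, (s ≠ 0 ∨ t ≠ 0) ∧ s • w + t • w' = 0)
    (hrel : ∃ x : L, x ≠ 0 ∧ φ x = 0) (hne : ∃ x : L, φ x ≠ 0) (F : Finset L) (hF : ∀ f ∈ F, 0 < φ f) :
    ∃ (ρ : ℕ), (ρ = 1 ∨ ρ = 2) ∧ ∃ M : Fin 3 → L,
      (∀ j : Fin 3, (j : ℕ) < ρ → 0 < φ (M j)) ∧ (∀ j : Fin 3, ρ ≤ (j : ℕ) → φ (M j) = 0) ∧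
      (∀ f ∈ F, ∃ d : Fin 3 → ℤ, f = ∑ j, d j • M j ∧ (∀ j : Fin 3, (j : ℕ) < ρ → 0 ≤ d j) ∧
        ∃ j : Fin 3, (j : ℕ) < ρ ∧ 0 < d j) ∧
      (∀ f : L, φ f = 0 → ∃ d : Fin 3 → ℤ, f = ∑ j, d j • M j ∧ ∀ j : Fin 3, (j : ℕ) < ρ → d j = 0) := by
  classical
  by_cases h2 : ∃ x y : L, φ x = 0 ∧ φ y = 0 ∧ ∀ s t : ℤ, s • x + t • y = 0 → s = 0 ∧ t = 0
  · -- CASE 1: the image of `φ` has rank one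
    obtain ⟨e, i₀, hpos, hker, hrepr, hposc⟩ :=
      UnimodularRefinement.exists_kernel_adapted_basis_of_rank_two_ker_pos b φ hne h2
    refine readout_rank_one φ F e i₀ hpos hker (fun f hf => hposc f (hF f hf)) fun f hf => ?_
    have h := hrepr f
    rw [hf] at h
    rcases lt_trichotomy (e.repr f i₀) 0 with hlt | heq | hgt
    · refine absurd h.symm (ne_of_lt ?_)
      have h' := zsmul_pos hpos (neg_pos.mpr hlt)
      rw [neg_zsmul] at h'
      exact neg_pos.mp h'
    · exact heq
    · exact absurd h.symm (ne_of_gt (zsmul_pos hpos hgt))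
  · -- CASE 2: `ψ ∘ φ ≠ 0` automatically, then the two-level reading and the class (C) lattice lemma
    have hneχ : ∃ x : L, ψ (φ x) ≠ 0 := by
      by_contra hall
      push Not at hall
      exact h2 (exists_indep_kernel_pair b φ fun i j => hΔ _ _ (hall _) (hall _))
    obtain ⟨φ₁, φ₂, hchar⟩ := UnimodularRefinement.exists_two_level_reading b φ ψ hψ hW₁ hΔ hneχ
    have hrel' : ∃ x : L, x ≠ 0 ∧ φ₁ x = 0 ∧ φ₂ x = 0 := by
      obtain ⟨x, hx0, hx⟩ := hrel
      exact ⟨x, hx0, ((hchar x).2).mp hx⟩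
    have hne' : ∃ x : L, φ₁ x ≠ 0 ∨ φ₂ x ≠ 0 := by
      obtain ⟨x, hx⟩ := hne
      refine ⟨x, ?_⟩
      by_contra h
      push Not at h
      exact hx (((hchar x).2).mpr h)
    have hF' : ∀ f ∈ F, 0 < φ₁ f ∨ (φ₁ f = 0 ∧ 0 < φ₂ f) := fun f hf => ((hchar f).1).mp (hF f hf)
    rcases UnimodularRefinement.toric_lemma_classC b φ₁ φ₂ hrel' hne' F hF' with
      ⟨e, m₁, m₂, a, b', c, d, he2, hdet, he0, he1, hm₁, hm₂, hkc, hFc⟩ | ⟨e, i₀, hpos, hker, hrepr, hposc⟩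
    · refine readout_rank_two φ F e m₁ m₂ a b' c d (((hchar _).2).mpr he2) (((hchar _).1).mpr (Or.inl hm₁))
        (((hchar _).1).mpr (Or.inr hm₂)) (fun f hf => ?_) fun f hf => ?_
      · have h := ((hchar f).2).mp hf
        exact hkc f h.1 h.2
      · obtain ⟨h1, h2', h3, h4⟩ := hFc f hf
        exact ⟨h1, h2', h3, h4.imp id And.right⟩
    · refine readout_rank_one φ F e i₀ (((hchar _).1).mpr hpos) (fun i hi => ((hchar _).2).mpr (hker i hi))
        (fun f hf => hposc f (hF' f hf)) fun f hf => ?_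
      have h := ((hchar f).2).mp hf
      obtain ⟨h1, h2'⟩ := hrepr f
      rcases hpos with hp1 | ⟨-, hp2⟩
      · rw [h.1] at h1
        exact (mul_eq_zero.mp h1.symm).resolve_right hp1.ne'
      · rw [h.2] at h2'
        exact (mul_eq_zero.mp h2'.symm).resolve_right hp2.ne'

/-- **(3-L-d) two-level data of a valuation ring with a PROPER COARSENING** (class (C)): if some valuation ring lies strictly between
`O` and `K` and `rank_ℤ Γ_O ≤ 2`, there is a coarsening `O₁` with the monotone units map `ψ` of `ValuationSubring.mapOfLE O O₁` such that
any two values in `Γ_{O₁}` and any two elements of `ker ψ` are `ℤ`-dependent (✓ `pair_dependent_of_rank_le_two_of_surjective`, ✓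
`ker_pair_dependent_of_rank_le_two`; `ker ψ ∋` the class of a unit of `O₁` outside `O` (`nonunits_le_nonunits`), `ψ ≠ 0` at an
element outside `O₁`).  PROVED. [folklore] -/
theorem valueGroup_twoLevel_data {K : Type} [Field K] (O : ValuationSubring K)
    (hW : Module.rank ℤ (Additive (ValuationSubring.ValueGroup O)ˣ) ≤ 2)
    (hB : ¬ ∀ O₁ : ValuationSubring K, O ≤ O₁ → O₁ = O ∨ O₁ = ⊤) :
    ∃ (O₁ : ValuationSubring K) (ψ : Additive (ValuationSubring.ValueGroup O)ˣ →+ Additive (ValuationSubring.ValueGroup O₁)ˣ),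
      Monotone ψ ∧
      (∀ w w' : Additive (ValuationSubring.ValueGroup O₁)ˣ, ∃ s t : ℤ, (s ≠ 0 ∨ t ≠ 0) ∧ s • w + t • w' = 0) ∧
      (∀ w w' : Additive (ValuationSubring.ValueGroup O)ˣ, ψ w = 0 → ψ w' = 0 →
        ∃ s t : ℤ, (s ≠ 0 ∨ t ≠ 0) ∧ s • w + t • w' = 0) := by
  classical
  push Not at hB
  obtain ⟨O₁, h, hne, hnetop⟩ := hB
  let f : O.ValueGroup →*₀ O₁.ValueGroup := O.mapOfLE O₁ h
  let ψm : (O.ValueGroup)ˣ →* (O₁.ValueGroup)ˣ := Units.map f.toMonoidHom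
  have hψm : ∀ u : (O.ValueGroup)ˣ, ((ψm u : (O₁.ValueGroup)ˣ) : O₁.ValueGroup) = f (u : O.ValueGroup) := fun u => rfl
  have hfval : ∀ x : K, f (O.valuation x) = O₁.valuation x := fun x => ValuationSubring.mapOfLE_valuation_apply O O₁ h x
  let ψ : Additive (O.ValueGroup)ˣ →+ Additive (O₁.ValueGroup)ˣ := MonoidHom.toAdditive ψm
  have hψ : ∀ a, ψ a = Additive.ofMul (ψm (Additive.toMul a)) := fun _ => rfl
  -- units attached to non-zero elements of `K`
  have hu : ∀ x : K, x ≠ 0 → ∃ u : (O.ValueGroup)ˣ, (u : O.ValueGroup) = O.valuation x := fun x hx =>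
    ⟨Units.mk0 (O.valuation x) ((Valuation.ne_zero_iff _).mpr hx), Units.val_mk0 _⟩
  have hψu : ∀ (x : K) (u : (O.ValueGroup)ˣ), (u : O.ValueGroup) = O.valuation x →
      ((ψm u : (O₁.ValueGroup)ˣ) : O₁.ValueGroup) = O₁.valuation x := by
    intro x u hux
    rw [hψm, hux, hfval]
  refine ⟨O₁, ψ, ?_, ?_, ?_⟩
  · -- monotone
    intro a b hab
    rw [hψ, hψ, Additive.ofMul_le, ← Units.val_le_val, hψm, hψm]
    exact ValuationSubring.monotone_mapOfLE O O₁ h (Units.val_le_val.mpr (Additive.toMul_le.mpr hab))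
  · -- (hW₁): surjectivity + a non-zero kernel element (a unit of `O₁` outside `O`)
    have hsurj : Function.Surjective ψ := by
      intro b
      obtain ⟨x, hx⟩ := O₁.valuation_surjective ((Additive.toMul b : (O₁.ValueGroup)ˣ) : O₁.ValueGroup)
      have hx0 : x ≠ 0 := fun h0 => (Additive.toMul b).ne_zero (by rw [← hx, h0, map_zero])
      obtain ⟨u, hux⟩ := hu x hx0
      refine ⟨Additive.ofMul u, ?_⟩
      rw [hψ]
      refine congrArg Additive.ofMul (Units.ext ?_) |>.trans (ofMul_toMul b)
      rw [toMul_ofMul, hψu x u hux, hx]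
    have hker : ∃ zW : Additive (O.ValueGroup)ˣ, zW ≠ 0 ∧ ψ zW = 0 := by
      obtain ⟨x, hx₁, hxO⟩ := SetLike.exists_of_lt (lt_of_le_of_ne h (Ne.symm hne))
      have hx0 : x ≠ 0 := fun h0 => hxO (h0 ▸ O.zero_mem)
      obtain ⟨u, hux⟩ := hu x hx0
      have hvO : O.valuation x ≠ 1 := fun h1 => hxO ((ValuationSubring.valuation_le_one_iff O x).mp h1.le)
      have hv₁ : O₁.valuation x = 1 := by
        refine le_antisymm ((ValuationSubring.valuation_le_one_iff O₁ x).mpr hx₁) (not_lt.mp fun hlt => hxO ?_)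
        have hxn : x ∈ O.nonunits := (ValuationSubring.nonunits_le_nonunits.mpr h) (O₁.mem_nonunits_iff.mpr hlt)
        exact (ValuationSubring.valuation_le_one_iff O x).mp (O.mem_nonunits_iff.mp hxn).le
      refine ⟨Additive.ofMul u, ?_, ?_⟩
      · intro h0
        apply hvO
        have hu1 : u = 1 := Additive.ofMul.injective (h0.trans ofMul_one.symm)
        rw [← hux, hu1, Units.val_one]
      · rw [hψ, toMul_ofMul, ← ofMul_one]
        exact congrArg Additive.ofMul (Units.ext (by rw [hψu x u hux, hv₁, Units.val_one]))
    exact Lens5RankOneArchimedean.pair_dependent_of_rank_le_two_of_surjective hW ψ hsurj hker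
  · -- (hΔ): a non-zero value of `ψ` (an element outside `O₁`)
    have hneψ : ∃ a : Additive (O.ValueGroup)ˣ, ψ a ≠ 0 := by
      obtain ⟨x, -, hx₁⟩ := SetLike.exists_of_lt (lt_top_iff_ne_top.mpr hnetop)
      have hx0 : x ≠ 0 := fun h0 => hx₁ (h0 ▸ O₁.zero_mem)
      obtain ⟨u, hux⟩ := hu x hx0
      have hv₁ : O₁.valuation x ≠ 1 := fun h1 => hx₁ ((ValuationSubring.valuation_le_one_iff O₁ x).mp h1.le)
      refine ⟨Additive.ofMul u, fun h0 => hv₁ ?_⟩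
      rw [hψ, toMul_ofMul, ← ofMul_one] at h0
      have h1 : ψm u = 1 := Additive.ofMul.injective h0
      rw [← hψu x u hux, h1, Units.val_one]
    exact Lens5RankOneArchimedean.ker_pair_dependent_of_rank_le_two hW ψ hneψ

/-- **PORT 3-L (the LATTICE half of PORT 3: the exponent-level toric chart).**  PROVED (rev 7) from (3-L-a,b,d) and the two abstract
lattice-chart lemmas (3-L-c1/c2): weights `ωᵢ = v(wᵢ)` in `W = Additive (Γ_O)ˣ`, `Ω ℓ = Σ ℓᵢ • ωᵢ` (so `v(z^C x^a y^b) =` the value of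
`Ω(θ(C,a,b))` by (3-L-a)), `φ = −Ω|L` on the exponent lattice `L` with a `Fin 3`-basis (3-L-b), `hrel` from `rank_ℤ W ≤ 2` (✓ R1A kit
`ratRank_le_two_of_stub` + `exists_ne_zero_map_eq_zero_of_rank_le_two`), `hne` from `v(z₀) < 1`, `F = {p·δᵢ} ∪ {θ e : e ∈ E, v < 1}`;
class split `hB`: archimedean (✓ `archimedean_additive_valueGroup_units`) ↦ (3-L-c1), proper coarsening ↦ (3-L-d) + (3-L-c2); then the
chart vectors are put in normal form `θ(c_j, a_j, b_j)`, `a_j, b_j < p`, and coordinates are read componentwise in `ℤ³`. [folklore] -/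
theorem port_toricChart_lattice (p : ℕ) [Fact p.Prime] {k : Type} [Field k] [CharP k p]
    {K : Type} [Field K] [Algebra k K] (O : ValuationSubring K) (A : Subalgebra k K)
    (hAO : A.toSubring ≤ O.toSubring) (hAfg : A.FG) [IsFractionRing A K] (hdimA : ringKrullDim A ≤ 3)
    (hdim3 : ringKrullDim (locAtCentre A.toSubring O) = 3)
    (htd : ∀ hk : ∀ c : k, algebraMap k K c ∈ O, transcendenceDefect k O hk ≠ 0)
    {x y : K} (hx : x ≠ 0) (hy : y ≠ 0)
    (hP : ∀ a b : ℕ, a < p → b < p → (a ≠ 0 ∨ b ≠ 0) → ∀ z : K, z ≠ 0 →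
      O.valuation (x ^ a * y ^ b) ≠ O.valuation (z ^ p))
    (z : Fin 3 → K) (hz0 : ∀ i, z i ≠ 0) (hzv : ∀ i, O.valuation (z i) < 1)
    (hzV : ∀ i, ∃ w : K, w ≠ 0 ∧ O.valuation (z i) = O.valuation (w ^ p))
    (α β : K) (hα : O.valuation α = 1) (hβ : O.valuation β = 1) (eA eB : Fin 3 → ℤ)
    (hxA : x ^ p = α * ∏ i, z i ^ eA i) (hyB : y ^ p = β * ∏ i, z i ^ eB i)
    (E : Finset ((Fin 3 → ℤ) × (Fin p × Fin p)))
    (hE : ∀ e ∈ E, O.valuation ((∏ i, z i ^ e.1 i) * (x ^ (e.2.1 : ℕ) * y ^ (e.2.2 : ℕ))) ≤ 1) :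
    ∃ (ρ : ℕ), (ρ = 1 ∨ ρ = 2) ∧
      ∃ (c : Fin 3 → Fin 3 → ℤ) (a b : Fin 3 → ℕ), (∀ j, a j < p) ∧ (∀ j, b j < p) ∧
        (∀ j : Fin 3, (j : ℕ) < ρ → O.valuation ((∏ i, z i ^ c j i) * (x ^ a j * y ^ b j)) < 1) ∧
        (∀ j : Fin 3, ρ ≤ (j : ℕ) → O.valuation ((∏ i, z i ^ c j i) * (x ^ a j * y ^ b j)) = 1) ∧
        (∀ i : Fin 3, ∃ d : Fin 3 → ℤ, (∀ j : Fin 3, (j : ℕ) < ρ → 0 ≤ d j) ∧ (∃ j : Fin 3, (j : ℕ) < ρ ∧ 0 < d j) ∧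
          ∀ i' : Fin 3, (if i' = i then (p : ℤ) else 0) =
            ∑ j, d j * ((p : ℤ) * c j i' + (a j : ℤ) * eA i' + (b j : ℤ) * eB i')) ∧
        (∀ e ∈ E, ∃ d : Fin 3 → ℤ, (∀ j : Fin 3, (j : ℕ) < ρ → 0 ≤ d j) ∧
          (O.valuation ((∏ i, z i ^ e.1 i) * (x ^ (e.2.1 : ℕ) * y ^ (e.2.2 : ℕ))) = 1 → ∀ j : Fin 3, (j : ℕ) < ρ → d j = 0) ∧
          ∀ i' : Fin 3, (p : ℤ) * e.1 i' + ((e.2.1 : ℕ) : ℤ) * eA i' + ((e.2.2 : ℕ) : ℤ) * eB i' =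
            ∑ j, d j * ((p : ℤ) * c j i' + (a j : ℤ) * eA i' + (b j : ℤ) * eB i')) := by
  classical
  have hp := (Fact.out : p.Prime)
  have hp0 : (p : ℤ) ≠ 0 := by exact_mod_cast hp.ne_zero
  set V := O.valuation with hV
  choose w hw0 hwv using hzV
  have hVw : ∀ i, V (w i) ≠ 0 := fun i => (Valuation.ne_zero_iff V).mpr (hw0 i)
  -- the weights `ωᵢ = v(wᵢ)` in the additive value group `W`, and `Ω ℓ = Σ ℓᵢ • ωᵢ`
  let γ : Fin 3 → (ValuationSubring.ValueGroup O)ˣ := fun i => Units.mk0 (V (w i)) (hVw i)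
  let ω : Fin 3 → Additive (ValuationSubring.ValueGroup O)ˣ := fun i => Additive.ofMul (γ i)
  let Ω : (Fin 3 → ℤ) →+ Additive (ValuationSubring.ValueGroup O)ˣ :=
    { toFun := fun ℓ => ∑ i, ℓ i • ω i
      map_zero' := by simp
      map_add' := fun u u' => by
        simp only [Pi.add_apply, add_smul, Finset.sum_add_distrib] }
  have hΩ : ∀ ℓ : Fin 3 → ℤ, Ω ℓ = ∑ i, ℓ i • ω i := fun _ => rfl
  have hΩval : ∀ ℓ : Fin 3 → ℤ,
      ((Additive.toMul (Ω ℓ) : (ValuationSubring.ValueGroup O)ˣ) : ValuationSubring.ValueGroup O) = ∏ i, V (w i) ^ ℓ i := by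
    intro ℓ
    rw [hΩ, toMul_sum, Units.coe_prod]
    refine Finset.prod_congr rfl fun i _ => ?_
    rw [toMul_zsmul, Units.val_zpow_eq_zpow_val]
    rfl
  -- values of monomials = values of `Ω`
  have hval : ∀ (C : Fin 3 → ℤ) (a b : ℕ), V ((∏ i, z i ^ C i) * (x ^ a * y ^ b)) =
      ((Additive.toMul (Ω fun i => (p : ℤ) * C i + (a : ℤ) * eA i + (b : ℤ) * eB i) : (ValuationSubring.ValueGroup O)ˣ) :
        ValuationSubring.ValueGroup O) := by
    intro C a b
    rw [hΩval]
    exact valuation_monomial_eq_prod_weights p O hx hy z hz0 w hw0 hwv α β hα hβ eA eB hxA hyB C a b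
  have hlt_iff : ∀ ℓ : Fin 3 → ℤ,
      ((Additive.toMul (Ω ℓ) : (ValuationSubring.ValueGroup O)ˣ) : ValuationSubring.ValueGroup O) < 1 ↔ Ω ℓ < 0 := by
    intro ℓ
    rw [← Units.val_one, Units.val_lt_val, ← toMul_zero, Additive.toMul_lt]
  have heq_iff : ∀ ℓ : Fin 3 → ℤ,
      ((Additive.toMul (Ω ℓ) : (ValuationSubring.ValueGroup O)ˣ) : ValuationSubring.ValueGroup O) = 1 ↔ Ω ℓ = 0 := by
    intro ℓ
    rw [← Units.val_one, Units.val_inj, ← toMul_zero, Additive.toMul.apply_eq_iff_eq]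
  -- the exponent lattice, a basis, the weight `φ = -Ω|L`
  set L := Submodule.span ℤ (Set.range fun i : Fin 3 => (Pi.single i (p : ℤ) : Fin 3 → ℤ)) ⊔ Submodule.span ℤ {eA, eB} with hL
  obtain ⟨bL⟩ := toricLattice_basis p hp.pos eA eB
  let φ : ↥L →+ Additive (ValuationSubring.ValueGroup O)ˣ := -(Ω.comp L.subtype.toAddMonoidHom)
  have hφ : ∀ f : L, φ f = -Ω (f : Fin 3 → ℤ) := fun _ => rfl
  -- rank ≤ 2 ⟹ a relation; `v(z₀) < 1` ⟹ non-triviality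
  have hk : ∀ c : k, algebraMap k K c ∈ O := fun c => hAO (A.algebraMap_mem c)
  have hW := Lens5RankOneArchimedean.ratRank_le_two_of_stub O A hAfg (ringKrullDim_eq_three_of_locAtCentre O A hAO hdimA hdim3) htd hk
  have hrel : ∃ f : L, f ≠ 0 ∧ φ f = 0 := Lens5RankOneArchimedean.exists_ne_zero_map_eq_zero_of_rank_le_two bL hW φ
  have hδmem : ∀ i : Fin 3, (Pi.single i (p : ℤ) : Fin 3 → ℤ) ∈ L := fun i =>
    Submodule.mem_sup_left (Submodule.subset_span ⟨i, rfl⟩)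
  have hδval : ∀ i : Fin 3,
      ((Additive.toMul (Ω (Pi.single i (p : ℤ))) : (ValuationSubring.ValueGroup O)ˣ) : ValuationSubring.ValueGroup O) = V (z i) := by
    intro i
    rw [hΩval, Finset.prod_eq_single i, Pi.single_eq_same, zpow_natCast, ← map_pow, hwv i]
    · intro j _ hj
      rw [Pi.single_eq_of_ne hj, zpow_zero]
    · intro h
      exact absurd (Finset.mem_univ i) h
  have hδpos : ∀ i : Fin 3, 0 < φ ⟨Pi.single i (p : ℤ), hδmem i⟩ := by
    intro i
    rw [hφ, neg_pos, ← hlt_iff, Subtype.coe_mk, hδval]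
    exact hzv i
  have hne : ∃ f : L, φ f ≠ 0 := ⟨⟨Pi.single 0 (p : ℤ), hδmem 0⟩, (hδpos 0).ne'⟩
  -- the finite set `F = {p·δᵢ} ∪ {θ e : e ∈ E, v < 1}`
  have hθmem : ∀ e : (Fin 3 → ℤ) × (Fin p × Fin p),
      (fun i => (p : ℤ) * e.1 i + ((e.2.1 : ℕ) : ℤ) * eA i + ((e.2.2 : ℕ) : ℤ) * eB i) ∈ L := fun e =>
    (mem_toricLattice_iff (p : ℤ) eA eB _).mpr ⟨e.1, _, _, fun i => rfl⟩
  let δL : Fin 3 → ↥L := fun i => ⟨Pi.single i (p : ℤ), hδmem i⟩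
  let θE : (Fin 3 → ℤ) × (Fin p × Fin p) → ↥L := fun e =>
    ⟨fun i => (p : ℤ) * e.1 i + ((e.2.1 : ℕ) : ℤ) * eA i + ((e.2.2 : ℕ) : ℤ) * eB i, hθmem e⟩
  let F : Finset ↥L := (Finset.univ.image δL) ∪
    ((E.filter fun e => V ((∏ i, z i ^ e.1 i) * (x ^ (e.2.1 : ℕ) * y ^ (e.2.2 : ℕ))) < 1).image θE)
  have hFδ : ∀ i, δL i ∈ F := fun i => Finset.mem_union_left _ (Finset.mem_image.mpr ⟨i, Finset.mem_univ i, rfl⟩)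
  have hFθ : ∀ e ∈ E, V ((∏ i, z i ^ e.1 i) * (x ^ (e.2.1 : ℕ) * y ^ (e.2.2 : ℕ))) < 1 → θE e ∈ F := fun e he hlt =>
    Finset.mem_union_right _ (Finset.mem_image.mpr ⟨e, Finset.mem_filter.mpr ⟨he, hlt⟩, rfl⟩)
  have hF : ∀ f ∈ F, 0 < φ f := by
    intro f hf
    rcases Finset.mem_union.mp hf with h | h
    · obtain ⟨i, -, rfl⟩ := Finset.mem_image.mp h
      exact hδpos i
    · obtain ⟨e, he, rfl⟩ := Finset.mem_image.mp h
      have hlt := (Finset.mem_filter.mp he).2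
      rw [hφ, neg_pos, ← hlt_iff]
      show ((Additive.toMul (Ω fun i => (p : ℤ) * e.1 i + ((e.2.1 : ℕ) : ℤ) * eA i + ((e.2.2 : ℕ) : ℤ) * eB i) :
        (ValuationSubring.ValueGroup O)ˣ) : ValuationSubring.ValueGroup O) < 1
      rw [← hval]
      exact hlt
  -- THE CHART (class split)
  obtain ⟨ρ, hρ, M, hMpos, hMzero, hFd, hKd⟩ : ∃ (ρ : ℕ), (ρ = 1 ∨ ρ = 2) ∧ ∃ M : Fin 3 → ↥L,
      (∀ j : Fin 3, (j : ℕ) < ρ → 0 < φ (M j)) ∧ (∀ j : Fin 3, ρ ≤ (j : ℕ) → φ (M j) = 0) ∧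
      (∀ f ∈ F, ∃ d : Fin 3 → ℤ, f = ∑ j, d j • M j ∧ (∀ j : Fin 3, (j : ℕ) < ρ → 0 ≤ d j) ∧
        ∃ j : Fin 3, (j : ℕ) < ρ ∧ 0 < d j) ∧
      (∀ f : ↥L, φ f = 0 → ∃ d : Fin 3 → ℤ, f = ∑ j, d j • M j ∧ ∀ j : Fin 3, (j : ℕ) < ρ → d j = 0) := by
    by_cases hB : ∀ O₁ : ValuationSubring K, O ≤ O₁ → O₁ = O ∨ O₁ = ⊤
    · haveI := Lens5RankOneArchimedean.archimedean_additive_valueGroup_units O hB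
      exact latticeChart_of_archimedean bL φ hrel hne F hF
    · obtain ⟨O₁, ψ, hψ, hW₁, hΔ⟩ := valueGroup_twoLevel_data O hW hB
      exact latticeChart_of_twoLevel bL φ ψ hψ hW₁ hΔ hrel hne F hF
  -- normal forms of the chart vectors
  have hnf : ∀ j : Fin 3, ∃ (C : Fin 3 → ℤ) (a b : ℕ), a < p ∧ b < p ∧
      ∀ i, (M j : Fin 3 → ℤ) i = (p : ℤ) * C i + (a : ℤ) * eA i + (b : ℤ) * eB i := by
    intro j
    obtain ⟨C, a, b, h⟩ := (mem_toricLattice_iff (p : ℤ) eA eB _).mp (M j).2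
    obtain ⟨C', a', b', ha', hb', h'⟩ := toricLattice_normalForm p hp.pos eA eB C a b
    exact ⟨C', a', b', ha', hb', fun i => (h i).trans (h' i)⟩
  choose c a b ha hb hM using hnf
  have hMvec : ∀ j, (M j : Fin 3 → ℤ) = fun i => (p : ℤ) * c j i + (a j : ℤ) * eA i + (b j : ℤ) * eB i :=
    fun j => funext (hM j)
  have hvalM : ∀ j, V ((∏ i, z i ^ c j i) * (x ^ a j * y ^ b j)) =
      ((Additive.toMul (Ω (M j : Fin 3 → ℤ)) : (ValuationSubring.ValueGroup O)ˣ) : ValuationSubring.ValueGroup O) := by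
    intro j
    rw [hval, ← hMvec j]
  -- reading coordinates componentwise in `ℤ³`
  have hcoord : ∀ (f : ↥L) (d : Fin 3 → ℤ), f = ∑ j, d j • M j → ∀ i' : Fin 3,
      (f : Fin 3 → ℤ) i' = ∑ j, d j * ((p : ℤ) * c j i' + (a j : ℤ) * eA i' + (b j : ℤ) * eB i') := by
    intro f d hf i'
    have h := congrArg (fun g : ↥L => (g : Fin 3 → ℤ) i') hf
    simp only [AddSubmonoidClass.coe_finsetSum, SetLike.val_smul, Finset.sum_apply, Pi.smul_apply, smul_eq_mul] at h
    rw [h]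
    exact Finset.sum_congr rfl fun j _ => by rw [hM j i']
  refine ⟨ρ, hρ, c, a, b, ha, hb, ?_, ?_, ?_, ?_⟩
  · intro j hj
    rw [hvalM j, hlt_iff, ← neg_pos, ← hφ]
    exact hMpos j hj
  · intro j hj
    rw [hvalM j, heq_iff, ← neg_eq_zero, ← hφ]
    exact hMzero j hj
  · intro i
    obtain ⟨d, hd, hd0, hdpos⟩ := hFd (δL i) (hFδ i)
    refine ⟨d, hd0, hdpos, fun i' => ?_⟩
    rw [← hcoord (δL i) d hd i']
    show (if i' = i then (p : ℤ) else 0) = (Pi.single i (p : ℤ) : Fin 3 → ℤ) i'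
    rw [Pi.single_apply]
  · intro e he
    by_cases hlt : V ((∏ i, z i ^ e.1 i) * (x ^ (e.2.1 : ℕ) * y ^ (e.2.2 : ℕ))) < 1
    · obtain ⟨d, hd, hd0, -⟩ := hFd (θE e) (hFθ e he hlt)
      exact ⟨d, hd0, fun h1 => absurd h1 (ne_of_lt hlt), fun i' => hcoord (θE e) d hd i'⟩
    · have h1 : V ((∏ i, z i ^ e.1 i) * (x ^ (e.2.1 : ℕ) * y ^ (e.2.2 : ℕ))) = 1 := le_antisymm (hE e he) (not_lt.mp hlt)
      have hφ0 : φ (θE e) = 0 := by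
        rw [hφ, neg_eq_zero, ← heq_iff]
        show ((Additive.toMul (Ω fun i => (p : ℤ) * e.1 i + ((e.2.1 : ℕ) : ℤ) * eA i + ((e.2.2 : ℕ) : ℤ) * eB i) :
          (ValuationSubring.ValueGroup O)ˣ) : ValuationSubring.ValueGroup O) = 1
        rw [← hval]
        exact h1
      obtain ⟨d, hd, hdz⟩ := hKd (θE e) hφ0
      exact ⟨d, fun j hj => le_of_eq (hdz j hj).symm, fun _ => hdz, fun i' => hcoord (θE e) d hd i'⟩


end Summit.ResolutionOfSingularities.ResolutionOfSingularities.Theorems.RadicialJung.CleanModels.Lens5.PRankTwoAssembly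

end
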